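import Summits.RiemannHypothesis.RiemannHypothesis.Theorems.MotivicDoorFunctionFieldExponent

/-!
# The function-field door (FF-DOOR, statement (ii)), exact form — part 4: the least admissible
# exponent in closed form
(pub-rhdoor, seat ff-2, gen 3; HONEST FRAMING: lottery ticket at the motivic door; RH probability
negligible; consolation prizes are real: a new semi-local Weil-positivity theorem, or a located gap in the
Connes–Consani programme, plus the ff-door theorem.  Nothing in this file is a statement about `ζ`.)

Part 2 (`MotivicDoorFunctionFieldExponent`) proved, modulo the named facts `hT : tateSimpleRigidity K`
and `hPW : frobCharpolyProdSimple K`, that for a monic `h ∈ ℤ[X]` of positive degree with Honda–Tate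
periods `e_m` of its monic irreducible factors `m` (multiplicities `k_m`) and `E ≥ 1`,
`(∃ C, P_C = h^E) ↔ ∀ m, e_m ∣ E·k_m`, and that the admissible exponents are the positive multiples of
ONE number `L` (`exists_generator_of_admissible_exponents`, an existence statement).  This file gives
`L` in CLOSED FORM, as stated informally in the paper (§4.4):

  `L = lcm_m  e_m / gcd(e_m, k_m)`   over the (finite) set of monic irreducible factors `m` of `h`.

PROVED here (kernel):
* `dvd_mul_iff_div_gcd_dvd` — for `e ≥ 1`: `e ∣ E·k ↔ e / gcd(e,k) ∣ E`.  [PROVED, arithmetic]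
* `mem_normalizedFactors_of_monic_irreducible_dvd`, `exists_finset_monic_irreducible_dvd` — the monic
  irreducible divisors of a monic `h ∈ ℤ[X]` are among its normalised factors, hence form a `Finset`
  (stated as `∃ S : Finset ℤ[X], ∀ m, m ∈ S ↔ m monic ∧ irreducible ∧ m ∣ h`; no new definition).  [PROVED]
* `isFrobCharpoly_pow_iff_lcm_dvd` — with such an `S`: `(∃ C, P_C = h^E) ↔ S.lcm (m ↦ e_m / gcd(e_m,k_m)) ∣ E`.
  [PROVED from hT, hPW; (⇐) alone needs nothing: `exists_isFrobCharpoly_pow_of_lcm_dvd`]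
* `lcmExponent_pos` — that `lcm` is `≥ 1`;  `isLeast_admissible_exponent` — it is the LEAST admissible
  exponent;  `isFrobCharpoly_iff_lcm_eq_one` — `h` itself is a `P_C` iff the `lcm` is `1`.
  [PROVED from hT, hPW]
-/

set_option linter.dupNamespace false  -- the mandated namespace repeats `RiemannHypothesis`

open Polynomial

namespace Summit.RiemannHypothesis.RiemannHypothesis.Theorems.MotivicDoor.FunctionField

open Literature.AlgebraicGeometry.Motives

universe u

variable {K : Type u} [Field K] [Finite K]

/-! ### Arithmetic: `e ∣ E·k ↔ e / gcd(e,k) ∣ E` -/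

omit [Field K] [Finite K] in
/-- For `e ≥ 1`: `e ∣ E * k ↔ e / gcd(e, k) ∣ E` (write `e = g e'`, `k = g k'` with `e', k'` coprime).
[PROVED] -/
theorem dvd_mul_iff_div_gcd_dvd {e k E : ℕ} (he : 0 < e) : e ∣ E * k ↔ e / Nat.gcd e k ∣ E := by
  have hg0 : 0 < Nat.gcd e k := Nat.gcd_pos_of_pos_left k he
  have hcop := Nat.coprime_div_gcd_div_gcd (m := e) (n := k) hg0
  have he' : Nat.gcd e k * (e / Nat.gcd e k) = e := Nat.mul_div_cancel' (Nat.gcd_dvd_left e k)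
  have hk' : Nat.gcd e k * (k / Nat.gcd e k) = k := Nat.mul_div_cancel' (Nat.gcd_dvd_right e k)
  constructor
  · intro h
    have h1 : Nat.gcd e k * (e / Nat.gcd e k) ∣ Nat.gcd e k * (E * (k / Nat.gcd e k)) := by
      have : Nat.gcd e k * (E * (k / Nat.gcd e k)) = E * k := by
        calc Nat.gcd e k * (E * (k / Nat.gcd e k)) = E * (Nat.gcd e k * (k / Nat.gcd e k)) := by ring
          _ = E * k := by rw [hk']
      rw [he', this]
      exact h
    exact hcop.dvd_mul_right.1 ((Nat.mul_dvd_mul_iff_left hg0).1 h1)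
  · intro h
    calc e = (e / Nat.gcd e k) * Nat.gcd e k := by rw [mul_comm]; exact he'.symm
      _ ∣ E * k := mul_dvd_mul h (Nat.gcd_dvd_right e k)

omit [Field K] [Finite K] in
/-- `e / gcd(e,k) ≥ 1` for `e ≥ 1`. [PROVED] -/
theorem div_gcd_pos {e k : ℕ} (he : 0 < e) : 0 < e / Nat.gcd e k :=
  Nat.div_pos (Nat.le_of_dvd he (Nat.gcd_dvd_left e k)) (Nat.gcd_pos_of_pos_left k he)

/-! ### The finite set of monic irreducible factors -/

omit [Field K] [Finite K] in
/-- A monic irreducible divisor of a monic `h ∈ ℤ[X]` is one of its normalised factors (it is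
associated with one, and both are fixed by `normalize`). [PROVED] -/
theorem mem_normalizedFactors_of_monic_irreducible_dvd {h m : ℤ[X]} (hh : h.Monic) (hm : m.Monic)
    (hirr : Irreducible m) (hdvd : m ∣ h) : m ∈ UniqueFactorizationMonoid.normalizedFactors h := by
  obtain ⟨q, hq, hmq⟩ :=
    UniqueFactorizationMonoid.exists_mem_normalizedFactors_of_dvd hh.ne_zero hirr hdvd
  have h1 : normalize m = normalize q := normalize_eq_normalize hmq.dvd hmq.symm.dvd
  rw [hm.normalize_eq_self, UniqueFactorizationMonoid.normalize_normalized_factor q hq] at h1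
  rwa [h1]

omit [Field K] [Finite K] in
/-- The monic irreducible divisors of a monic `h ∈ ℤ[X]` form a finite set. (Stated as the existence of a
`Finset` with the right membership, so that no new definition is introduced.) [PROVED] -/
theorem exists_finset_monic_irreducible_dvd {h : ℤ[X]} (hh : h.Monic) :
    ∃ S : Finset ℤ[X], ∀ m : ℤ[X], m ∈ S ↔ m.Monic ∧ Irreducible m ∧ m ∣ h := by
  classical
  refine ⟨(UniqueFactorizationMonoid.normalizedFactors h).toFinset.filter fun m => m.Monic,
    fun m => ?_⟩
  simp only [Finset.mem_filter, Multiset.mem_toFinset]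
  constructor
  · rintro ⟨hmem, hmon⟩
    exact ⟨hmon, UniqueFactorizationMonoid.irreducible_of_normalized_factor m hmem,
      UniqueFactorizationMonoid.dvd_of_mem_normalizedFactors hmem⟩
  · rintro ⟨hmon, hirr, hd⟩
    exact ⟨mem_normalizedFactors_of_monic_irreducible_dvd hh hmon hirr hd, hmon⟩

/-! ### The least admissible exponent in closed form -/

/-- **The exact exponent set, closed form.**  Let `h ∈ ℤ[X]` be monic of positive degree, `e_m` the
Honda–Tate period of each monic irreducible `m ∣ h`, `S` the finite set of these `m`, and `E ≥ 1`.  Then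
`(∃ C, P_C = h^E) ↔ lcm_{m ∈ S} (e_m / gcd(e_m, mult_m h)) ∣ E`. [PROVED from hT, hPW] -/
theorem isFrobCharpoly_pow_iff_lcm_dvd (hT : AbelianVariety.tateSimpleRigidity K)
    (hPW : AbelianVariety.frobCharpolyProdSimple K) {h : ℤ[X]} (hh : h.Monic) (hdeg : 0 < h.natDegree)
    {e : ℤ[X] → ℕ} (he : ∀ m : ℤ[X], m.Monic → Irreducible m → m ∣ h → IsHTPeriod K m (e m))
    {S : Finset ℤ[X]} (hS : ∀ m : ℤ[X], m ∈ S ↔ m.Monic ∧ Irreducible m ∧ m ∣ h) {E : ℕ} (hE : 0 < E) :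
    (∃ C : AbelianVariety K, C.IsFrobCharpoly (h ^ E)) ↔
      S.lcm (fun m => e m / Nat.gcd (e m) (multiplicity m h)) ∣ E := by
  rw [isFrobCharpoly_pow_iff_forall_period_dvd hT hPW hh hdeg he hE, Finset.lcm_dvd_iff]
  constructor
  · intro H m hm
    obtain ⟨hmon, hirr, hd⟩ := (hS m).1 hm
    exact (dvd_mul_iff_div_gcd_dvd (he m hmon hirr hd).1).1 (H m hmon hirr hd)
  · intro H m hmon hirr hd
    exact (dvd_mul_iff_div_gcd_dvd (he m hmon hirr hd).1).2 (H m ((hS m).2 ⟨hmon, hirr, hd⟩))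

/-- The `(⇐)` half needs no named fact: every positive multiple of the `lcm` is admissible. [PROVED] -/
theorem exists_isFrobCharpoly_pow_of_lcm_dvd {h : ℤ[X]} (hh : h.Monic) (hdeg : 0 < h.natDegree)
    {e : ℤ[X] → ℕ} (he : ∀ m : ℤ[X], m.Monic → Irreducible m → m ∣ h → IsHTPeriod K m (e m))
    {S : Finset ℤ[X]} (hS : ∀ m : ℤ[X], m ∈ S ↔ m.Monic ∧ Irreducible m ∧ m ∣ h) {E : ℕ} (hE : 0 < E)
    (hdvd : S.lcm (fun m => e m / Nat.gcd (e m) (multiplicity m h)) ∣ E) :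
    ∃ C : AbelianVariety K, C.IsFrobCharpoly (h ^ E) := by
  refine exists_isFrobCharpoly_pow_of_period_dvd hh hdeg hE he fun m hmon hirr hd => ?_
  rw [Finset.lcm_dvd_iff] at hdvd
  exact (dvd_mul_iff_div_gcd_dvd (he m hmon hirr hd).1).2 (hdvd m ((hS m).2 ⟨hmon, hirr, hd⟩))

/-- The closed-form generator is positive. [PROVED] -/
theorem lcmExponent_pos {h : ℤ[X]} {e : ℤ[X] → ℕ}
    (he : ∀ m : ℤ[X], m.Monic → Irreducible m → m ∣ h → IsHTPeriod K m (e m)) {S : Finset ℤ[X]}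
    (hS : ∀ m : ℤ[X], m ∈ S ↔ m.Monic ∧ Irreducible m ∧ m ∣ h) :
    0 < S.lcm (fun m => e m / Nat.gcd (e m) (multiplicity m h)) := by
  apply Nat.pos_of_ne_zero
  rw [Ne, Finset.lcm_eq_zero_iff]
  rintro ⟨m, hm, h0⟩
  obtain ⟨hmon, hirr, hd⟩ := (hS m).1 hm
  have := div_gcd_pos (k := multiplicity m h) (he m hmon hirr hd).1
  omega

/-- **The least admissible exponent** of an RH-true Weil datum is `lcm_m e_m / gcd(e_m, mult_m h)`:
it is admissible, and divides (in particular is at most) every admissible exponent. [PROVED from hT, hPW] -/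
theorem isLeast_admissible_exponent (hT : AbelianVariety.tateSimpleRigidity K)
    (hPW : AbelianVariety.frobCharpolyProdSimple K) {h : ℤ[X]} (hh : h.Monic) (hdeg : 0 < h.natDegree)
    {e : ℤ[X] → ℕ} (he : ∀ m : ℤ[X], m.Monic → Irreducible m → m ∣ h → IsHTPeriod K m (e m))
    {S : Finset ℤ[X]} (hS : ∀ m : ℤ[X], m ∈ S ↔ m.Monic ∧ Irreducible m ∧ m ∣ h) :
    IsLeast {E : ℕ | 0 < E ∧ ∃ C : AbelianVariety K, C.IsFrobCharpoly (h ^ E)}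
      (S.lcm (fun m => e m / Nat.gcd (e m) (multiplicity m h))) := by
  have hL := lcmExponent_pos he hS
  refine ⟨⟨hL, exists_isFrobCharpoly_pow_of_lcm_dvd hh hdeg he hS hL dvd_rfl⟩, ?_⟩
  rintro E ⟨hE, hC⟩
  exact Nat.le_of_dvd hE ((isFrobCharpoly_pow_iff_lcm_dvd hT hPW hh hdeg he hS hE).1 hC)

/-- `h` itself is the characteristic polynomial of the Frobenius of an abelian variety over `K` iff the
closed-form generator is `1`, i.e. iff `e_m ∣ mult_m h` for every `m`. [PROVED from hT, hPW] -/
theorem isFrobCharpoly_iff_lcm_eq_one (hT : AbelianVariety.tateSimpleRigidity K)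
    (hPW : AbelianVariety.frobCharpolyProdSimple K) {h : ℤ[X]} (hh : h.Monic) (hdeg : 0 < h.natDegree)
    {e : ℤ[X] → ℕ} (he : ∀ m : ℤ[X], m.Monic → Irreducible m → m ∣ h → IsHTPeriod K m (e m))
    {S : Finset ℤ[X]} (hS : ∀ m : ℤ[X], m ∈ S ↔ m.Monic ∧ Irreducible m ∧ m ∣ h) :
    (∃ C : AbelianVariety K, C.IsFrobCharpoly h) ↔
      S.lcm (fun m => e m / Nat.gcd (e m) (multiplicity m h)) = 1 := by
  have := isFrobCharpoly_pow_iff_lcm_dvd hT hPW hh hdeg he hS Nat.one_pos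
  rw [pow_one] at this
  rw [this, Nat.dvd_one]

end Summit.RiemannHypothesis.RiemannHypothesis.Theorems.MotivicDoor.FunctionField
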